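import Summits.AtomisticToContinuum.HydrodynamicLimit.Theses.InformationPercolationEngine

/-!
# The shielded cap of impact vectors is EMPTY (hard-core geometry behind `¬ KickIsotropyInfo`)

Negative-side support for the crux `InformationPercolationEngine.KickIsotropyInfo`
(stmt-AtomisticToContinuum-13478), from the standing disprover's `Cruxes/KickIsotropyInfo/Disproof.lean` §7 —
the deterministic core of the third-body shielding mechanism of
`Negative/KickIsotropyInfoFalseOfShieldingBiasPersists.lean` (`H = ShieldingBiasPersists`):

* `inner_contact_le_of_touching` — two spheres of diameter `ε` touching a third without overlapping each other
  have contact directions at least `60°` apart: `⟪x_i - x_p, x_l - x_p⟫ ≤ ε²/2`. Hence the cap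
  `{ω : ⟪ω, ω_l⟫ > 1/2}` of impact vectors of ANY collision of `p` is empty while `l` is adjacent (Enskog's
  shielding, Chapman–Cowling 1970 §16.21, made DIRECTIONAL by the velocity history of the typed past);
* `two_inner_contact_le_of_receding` — the receding version: at centre distance `ε + d` the empty cap has
  `cos(half-angle) = (ε + d)/(2ε)` and closes exactly at `d = ε` (so the biased stratum is the flights shorter
  than `≈ ε`, probability `≈ ε/ℓ = √2 π σ³`, independent of `N`);
* `reflectVel_fst_sub`, `kick_direction` — the elastic kick received by a sphere is a positive multiple of the
  contact vector (incoming sign), so the velocity change between the two snapshots of the typed coarse past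
  REVEALS the contact direction of the partner's previous collision — the leak the weights `h` exploit.
No statement of the route is asserted here, positively or negatively.
refuter-cdisprove-stmt-AtomisticToContinuum-13478-g2-0.
-/

open scoped InnerProductSpace

namespace Summit.AtomisticToContinuum.HydrodynamicLimit.Theorems.KickIsotropyInfoNegative

noncomputable section

open Literature.MathematicalPhysics.KineticTheory (V3)

/-- **Shielded cap at contact.** If spheres `i` and `l` (diameter `ε`) both touch sphere `p` and do
not overlap each other, the two contact directions are at least `60°` apart:
`⟪x_i - x_p, x_l - x_p⟫ ≤ ε² / 2`. Equivalently the cap `{ω : ⟪ω, ω_l⟫ > 1/2}` of impact vectors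
of ANY collision of `p` is empty while `l` is adjacent. [folklore] -/
theorem inner_contact_le_of_touching {x_p x_i x_l : V3} {ε : ℝ} (hi : ‖x_i - x_p‖ = ε)
    (hl : ‖x_l - x_p‖ = ε) (hil : ε ≤ ‖x_i - x_l‖) (hε : 0 ≤ ε) :
    ⟪x_i - x_p, x_l - x_p⟫_ℝ ≤ ε ^ 2 / 2 := by
  have hsq : ε ^ 2 ≤ ‖x_i - x_l‖ ^ 2 := pow_le_pow_left₀ hε hil 2
  have hdecomp : x_i - x_l = (x_i - x_p) - (x_l - x_p) := by abel
  have hexp : ‖x_i - x_l‖ ^ 2 =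
      ‖x_i - x_p‖ ^ 2 - 2 * ⟪x_i - x_p, x_l - x_p⟫_ℝ + ‖x_l - x_p‖ ^ 2 := by
    rw [hdecomp]; exact norm_sub_sq_real _ _
  rw [hexp, hi, hl] at hsq
  linarith

/-- **Receding third body.** If `l` has receded to centre distance `ε + d` from `p`, a sphere `i`
touching `p` without overlapping `l` satisfies `2 ⟪x_i - x_p, x_l - x_p⟫ ≤ (ε + d)²`: the empty cap
has `cos(half-angle) = (ε + d)/(2ε)` and closes exactly at `d = ε`. [folklore] -/
theorem two_inner_contact_le_of_receding {x_p x_i x_l : V3} {ε d : ℝ} (hi : ‖x_i - x_p‖ = ε)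
    (hl : ‖x_l - x_p‖ = ε + d) (hil : ε ≤ ‖x_i - x_l‖) (hε : 0 ≤ ε) :
    2 * ⟪x_i - x_p, x_l - x_p⟫_ℝ ≤ (ε + d) ^ 2 := by
  have hsq : ε ^ 2 ≤ ‖x_i - x_l‖ ^ 2 := pow_le_pow_left₀ hε hil 2
  have hdecomp : x_i - x_l = (x_i - x_p) - (x_l - x_p) := by abel
  have hexp : ‖x_i - x_l‖ ^ 2 =
      ‖x_i - x_p‖ ^ 2 - 2 * ⟪x_i - x_p, x_l - x_p⟫_ℝ + ‖x_l - x_p‖ ^ 2 := by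
    rw [hdecomp]; exact norm_sub_sq_real _ _
  rw [hexp, hi, hl] at hsq
  nlinarith

/-- **The kick reveals the contact direction.** In an elastic collision of `p` (velocity `w₁`)
with `l` (velocity `u`) at contact vector `n = x_p - x_l`, the momentum received by `p` is
parallel to `n`: `w - w₁ = -(⟪w₁ - u, n⟫/‖n‖²) n` (`reflectVel`). [folklore] -/
theorem reflectVel_fst_sub (n w₁ u : V3) :
    (Literature.Analysis.FluidPDE.reflectVel n (w₁, u)).1 - w₁ =
      -((⟪w₁ - u, n⟫_ℝ / ‖n‖ ^ 2) • n) := by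
  simp [Literature.Analysis.FluidPDE.reflectVel]

/-- With the incoming sign (`⟪w₁ - u, n⟫ < 0`) the kick is a POSITIVE multiple of the contact
vector, so the velocity change between the two snapshots of the typed past determines `n/‖n‖`.
[folklore] -/
theorem kick_direction {n w₁ u : V3} (hn : n ≠ 0) (hin : ⟪w₁ - u, n⟫_ℝ < 0) :
    ∃ c : ℝ, 0 < c ∧ (Literature.Analysis.FluidPDE.reflectVel n (w₁, u)).1 - w₁ = c • n := by
  refine ⟨-(⟪w₁ - u, n⟫_ℝ / ‖n‖ ^ 2), ?_, ?_⟩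
  · have hn2 : 0 < ‖n‖ ^ 2 := by positivity
    have : ⟪w₁ - u, n⟫_ℝ / ‖n‖ ^ 2 < 0 := div_neg_of_neg_of_pos hin hn2
    linarith
  · rw [reflectVel_fst_sub, neg_smul]

end

end Summit.AtomisticToContinuum.HydrodynamicLimit.Theorems.KickIsotropyInfoNegative
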